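import Literature.NumberTheory.ComplexMultiplication.CMTypeRankCharacters
import HarnessLib

/-!
# Right ideals, VI: character count — on a finite COMMUTATIVE group the ideals generated by rational vectors
# `f_i` have `dim Σ_i f_iℚ[H] = #{ψ ∈ Ĥ : some f̂_i(ψ) ≠ 0}`, so the defect is an excess multiplicity of characters

COR-CM (cell `pub-hodgecm2`, binder seat `b16` gen 64, count-neutral claim RIGHT IDEALS, file R6 — abstract level, a
finite commutative group; theorems only, no definition, no named fact, no `sorry`).  NEW as stated, hence under
`Summits/`.  HONEST FRAMING: Kubota's Fourier mechanism (tree: `Literature/…/TypeRankCharacterSums`, one SUBSET;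
`…/CMTypeRankCharactersFamilies`, a family of SUBSETS) run for a family of arbitrary RATIONAL VECTORS — needed because the
shadows of CM types on a pivot (R3–R5) are integer vectors, not indicators; `HC_CM` is neither used nor asserted.

* **`finrank_span_translates_eq_ncard`** — for `f : ι → H → ℚ` on a finite commutative group `H`:
  `dim_ℚ span{x ↦ f_i(xδ) : i ∈ ι, δ ∈ H} = #{ψ ∈ Ĥ : ∃ i, Σ_x f_i(x)ψ(x) ≠ 0}` — the translates expand as
  `f_i(xδ) = Σ_ψ ĉ_i(ψ)ψ(δ)ψ(x)` with `ĉ_i(ψ) = |H|⁻¹ Σ_x f_i(x)ψ̄(x)`, orthogonality recovers every `ψ` with some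
  `ĉ_i(ψ) ≠ 0`, the characters are linearly independent, `ℚ → ℂ` base change (`finrank_span_range_ratCast_eq`), and
  `ψ ↦ ψ̄` matches the two counts.  `finrank_iSup_span_translates_eq_ncard` (the `⨆_i` form),
  `finrank_span_translates_eq_ncard_single` (one vector: `dim fℚ[H] = #supp f̂`).
* **`sum_ncard_eq_ncard_iUnion_add_defect`** — hence for the ideals `J_i = f_iℚ[H]`:
  `Σ_i dim J_i + #(⋃_i S_i) = Σ_i #S_i + dim Σ_i J_i` with `S_i = {ψ : Σ_x f_i(x)ψ(x) ≠ 0}`, i.e. the defect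
  `Σ_i dim J_i − dim Σ_i J_i` is the EXCESS MULTIPLICITY `Σ_i #S_i − #⋃_i S_i = Σ_ψ (n_ψ − 1)⁺`, `n_ψ = #{i : ψ ∈ S_i}`;
  for two vectors `dim(J₀ ∩ J₁) = #(S₀ ∩ S₁)` (`finrank_inf_span_translates_eq_ncard_inter`).
* CM dress (abelian pivots): R6b `IrreducibleOddWeightsRightIdealsCharactersCMFields` — with R5b,
  `Σ_i dim Hg(A_i) − dim Hg(∏_i A_i) = Σ_i #S_i − #⋃_i S_i` for the characters `S_i` of `Gal(M/ℚ)` seen by the shadows.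

## References

* [Kubota1965] T. Kubota, *On the field extension by complex multiplication*, Trans. AMS 118 (1965), §2 Lemma 1, §4
  Lemma 2 (proof).
* [Gordon1999HodgeAVSurvey] B. B. Gordon, *A survey of the Hodge conjecture for abelian varieties*, Prop. 9.4.1, 7.5–7.7.
* [Deligne1982HodgeCycles] P. Deligne, *Hodge cycles on abelian varieties*, LNM 900 (1982), I Ex. 3.7 (c).
-/

set_option autoImplicit false

noncomputable section

open scoped BigOperators

universe u v

namespace Summit.HodgeConjecture.CorCM.IrrOdd

open Literature.NumberTheory.ComplexMultiplication
open AddChar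

variable {H : Type u} [CommGroup H] [Fintype H] {ι : Type v} [Fintype ι]

/-- **`dim_ℚ span{f_i(·δ) : i, δ} = #{ψ : ∃ i, Σ_x f_i(x)ψ(x) ≠ 0}`** for rational vectors `f_i` on a finite commutative
group (Kubota's Fourier argument for a family of arbitrary vectors: the translates expand in the characters, orthogonality
recovers each character with a non-zero coefficient, and `ψ ↦ ψ̄` matches the counts).
[cite: Kubota1965, §2 Lemma 1 and §4 Lemma 2 (proof)] -/
theorem finrank_span_translates_eq_ncard (f : ι → H → ℚ) :
    Module.finrank ℚ (Submodule.span ℚ (Set.range fun p : ι × H => fun x : H => f p.1 (x * p.2))) =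
      {ψ : AddChar (Additive H) ℂ | ∃ i, ∑ x : H, (f i x : ℂ) * ψ (Additive.ofMul x) ≠ 0}.ncard := by
  classical
  -- characters as complex functions on `H`
  let cf : AddChar (Additive H) ℂ → H → ℂ := fun ψ x => ψ (Additive.ofMul x)
  have cf_mul : ∀ (ψ : AddChar (Additive H) ℂ) (x y : H), cf ψ (x * y) = cf ψ x * cf ψ y := fun ψ x y => by
    simp only [cf, ofMul_mul, AddChar.map_add_eq_mul]
  have hli : LinearIndependent ℂ cf := by
    have h := AddChar.linearIndependent (Additive H) ℂ
    let L : (Additive H → ℂ) ≃ₗ[ℂ] (H → ℂ) := LinearEquiv.funCongrLeft ℂ ℂ Additive.toMul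
    have hcf : cf = L ∘ ((⇑) : AddChar (Additive H) ℂ → Additive H → ℂ) := by
      funext ψ x; rfl
    rw [hcf]
    exact h.map' L.toLinearMap L.ker
  have hcard : (Fintype.card H : ℂ) ≠ 0 := Nat.cast_ne_zero.2 Fintype.card_ne_zero
  -- dual orthogonality `Σ_ψ ψ(x) = |H| [x = 1]`
  have horth : ∀ x : H, ∑ ψ : AddChar (Additive H) ℂ, cf ψ x = if x = 1 then (Fintype.card H : ℂ) else 0 := by
    intro x
    have h := AddChar.sum_apply_eq_ite (α := Additive H) (Additive.ofMul x)
    have hc : Fintype.card (Additive H) = Fintype.card H := Fintype.card_congr Additive.toMul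
    simp only [cf]
    rw [h, hc]
    by_cases hx : x = 1
    · subst hx; simp
    · rw [if_neg hx, if_neg]
      exact fun h' => hx (Additive.ofMul.injective (by rw [h']; rfl))
  -- Fourier coefficients and the expansion of the translates
  let co : ι → AddChar (Additive H) ℂ → ℂ := fun i ψ => (Fintype.card H : ℂ)⁻¹ * ∑ s : H, (f i s : ℂ) * cf ψ s⁻¹
  let tr : ι × H → H → ℂ := fun p x => ((f p.1 (x * p.2) : ℚ) : ℂ)
  have htr : ∀ p : ι × H, tr p = ∑ ψ : AddChar (Additive H) ℂ, (co p.1 ψ * cf ψ p.2) • cf ψ := by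
    rintro ⟨i, g⟩
    funext x
    simp only [tr, co, Finset.sum_apply, Pi.smul_apply, smul_eq_mul]
    have h1 : ∀ ψ : AddChar (Additive H) ℂ,
        (Fintype.card H : ℂ)⁻¹ * (∑ s : H, (f i s : ℂ) * cf ψ s⁻¹) * cf ψ g * cf ψ x =
          (Fintype.card H : ℂ)⁻¹ * ∑ s : H, (f i s : ℂ) * cf ψ (x * g * s⁻¹) := by
      intro ψ
      rw [Finset.mul_sum, Finset.mul_sum, Finset.sum_mul, Finset.sum_mul]
      refine Finset.sum_congr rfl fun s _ => ?_
      rw [cf_mul, cf_mul]; ring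
    simp_rw [h1]
    rw [← Finset.mul_sum, Finset.sum_comm]
    simp_rw [← Finset.mul_sum, horth]
    have h2 : ∑ s : H, (f i s : ℂ) * (if x * g * s⁻¹ = 1 then (Fintype.card H : ℂ) else 0) =
        (f i (x * g) : ℂ) * (Fintype.card H : ℂ) := by
      have h3 : ∀ s : H, (x * g * s⁻¹ = 1) ↔ x * g = s := fun s => by rw [mul_inv_eq_one]
      simp_rw [h3, mul_ite, mul_zero]
      rw [Finset.sum_ite_eq Finset.univ (x * g) (fun s => (f i s : ℂ) * (Fintype.card H : ℂ)), if_pos (Finset.mem_univ _)]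
    rw [h2, ← mul_assoc, mul_comm ((Fintype.card H : ℂ)⁻¹), mul_assoc, inv_mul_cancel₀ hcard, mul_one]
  -- the span of the translates is the span of the characters with some `co_i ≠ 0`
  set C : Set (AddChar (Additive H) ℂ) := {ψ | ∃ i, co i ψ ≠ 0} with hC
  have hspan : Submodule.span ℂ (Set.range tr) = Submodule.span ℂ (cf '' C) := by
    refine le_antisymm (Submodule.span_le.2 ?_) (Submodule.span_le.2 ?_)
    · rintro _ ⟨p, rfl⟩
      rw [htr p]
      refine Submodule.sum_mem _ fun ψ _ => ?_
      by_cases hψ : co p.1 ψ = 0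
      · rw [hψ, zero_mul, zero_smul]; exact Submodule.zero_mem _
      · exact Submodule.smul_mem _ _ (Submodule.subset_span ⟨ψ, ⟨p.1, hψ⟩, rfl⟩)
    · rintro _ ⟨ψ₀, ⟨i, hψ₀⟩, rfl⟩
      -- `Σ_g ψ₀(g⁻¹) tr (i, g) = |H| co_i(ψ₀) ψ₀`
      have hsum : ∑ g : H, cf ψ₀ g⁻¹ • tr (i, g) = ((Fintype.card H : ℂ) * co i ψ₀) • cf ψ₀ := by
        simp_rw [htr, Finset.smul_sum, smul_smul]
        rw [Finset.sum_comm]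
        have h1 : ∀ ψ : AddChar (Additive H) ℂ, ∑ g : H, (cf ψ₀ g⁻¹ * (co i ψ * cf ψ g)) • cf ψ =
            (co i ψ * ∑ g : H, cf (ψ - ψ₀) g) • cf ψ := by
          intro ψ
          rw [← Finset.sum_smul, Finset.mul_sum]
          congr 1
          refine Finset.sum_congr rfl fun g _ => ?_
          simp only [cf, AddChar.sub_apply, ofMul_inv]
          ring
        simp_rw [h1]
        have h2 : ∀ ψ : AddChar (Additive H) ℂ, ∑ g : H, cf (ψ - ψ₀) g =
            if ψ - ψ₀ = 0 then (Fintype.card H : ℂ) else 0 := by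
          intro ψ
          have h := AddChar.sum_eq_ite (ψ - ψ₀)
          have hc : Fintype.card (Additive H) = Fintype.card H := Fintype.card_congr Additive.toMul
          rw [hc] at h
          rw [← h]
          exact Fintype.sum_equiv Additive.ofMul _ _ fun x => rfl
        simp_rw [h2, sub_eq_zero]
        rw [Finset.sum_eq_single ψ₀]
        · rw [if_pos rfl]; ring_nf
        · intro ψ _ hne; rw [if_neg hne, mul_zero, zero_smul]
        · intro h; exact absurd (Finset.mem_univ ψ₀) h
      have hc : (Fintype.card H : ℂ) * co i ψ₀ ≠ 0 := mul_ne_zero hcard hψ₀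
      have hmem : ((Fintype.card H : ℂ) * co i ψ₀) • cf ψ₀ ∈ Submodule.span ℂ (Set.range tr) := by
        rw [← hsum]
        exact Submodule.sum_mem _ fun g _ => Submodule.smul_mem _ _ (Submodule.subset_span ⟨(i, g), rfl⟩)
      have := Submodule.smul_mem _ ((Fintype.card H : ℂ) * co i ψ₀)⁻¹ hmem
      rwa [smul_smul, inv_mul_cancel₀ hc, one_smul] at this
  -- count: `dim = #C`
  have hrank : Module.finrank ℚ (Submodule.span ℚ (Set.range fun p : ι × H => fun x : H => f p.1 (x * p.2))) =
      C.ncard := by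
    rw [← finrank_span_range_ratCast_eq (E := H) (fun p : ι × H => fun x : H => f p.1 (x * p.2))]
    change Module.finrank ℂ (Submodule.span ℂ (Set.range tr)) = _
    rw [hspan]
    haveI : Fintype C := Fintype.ofFinite C
    have hli' : LinearIndependent ℂ (fun ψ : C => cf (ψ : AddChar (Additive H) ℂ)) :=
      hli.comp _ Subtype.val_injective
    have hr : cf '' C = Set.range (fun ψ : C => cf (ψ : AddChar (Additive H) ℂ)) := by
      ext f'; simp only [Set.mem_image, Set.mem_range, Subtype.exists, exists_prop]
    rw [hr, finrank_span_eq_card hli', Set.ncard_eq_toFinset_card', Set.toFinset_card]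
  -- `C = −{ψ | ∃ i, Σ_x f_i(x) ψ(x) ≠ 0}` under `ψ ↦ −ψ`
  have hCeq : C = (fun ψ => -ψ) ''
      {ψ : AddChar (Additive H) ℂ | ∃ i, ∑ x : H, (f i x : ℂ) * ψ (Additive.ofMul x) ≠ 0} := by
    ext ψ
    simp only [hC, Set.mem_setOf_eq, Set.mem_image, co, cf]
    constructor
    · rintro ⟨i, h⟩
      refine ⟨-ψ, ⟨i, ?_⟩, neg_neg ψ⟩
      intro h0
      apply h
      rw [show (∑ s : H, (f i s : ℂ) * ψ (Additive.ofMul s⁻¹)) = ∑ s : H, (f i s : ℂ) * (-ψ) (Additive.ofMul s) from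
        Finset.sum_congr rfl fun s _ => by rw [AddChar.neg_apply, ofMul_inv], h0, mul_zero]
    · rintro ⟨ψ', ⟨i, hψ'⟩, rfl⟩
      refine ⟨i, mul_ne_zero (inv_ne_zero hcard) ?_⟩
      rw [show (∑ s : H, (f i s : ℂ) * (-ψ') (Additive.ofMul s⁻¹)) = ∑ s : H, (f i s : ℂ) * ψ' (Additive.ofMul s) from
        Finset.sum_congr rfl fun s _ => by rw [AddChar.neg_apply, ofMul_inv, neg_neg]]
      exact hψ'
  rw [hrank, hCeq, Set.ncard_image_of_injective _ neg_injective]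

omit [Fintype H] [Fintype ι] in
/-- The translates of a family, indexed by `ι × H`, span the `⨆_i` of the spans of the translates of the members.
[folklore] -/
theorem span_range_prod_eq_iSup (f : ι → H → ℚ) :
    Submodule.span ℚ (Set.range fun p : ι × H => fun x : H => f p.1 (x * p.2)) =
      ⨆ i, Submodule.span ℚ (Set.range fun δ : H => fun x : H => f i (x * δ)) := by
  rw [← Submodule.span_iUnion]
  congr 1
  exact Set.ext fun c => by simp only [Set.mem_range, Set.mem_iUnion, Prod.exists]

/-- **`dim Σ_i f_iℚ[H] = #{ψ : ∃ i, Σ_x f_i(x)ψ(x) ≠ 0}`** (`⨆` form): the sum of the ideals generated by the `f_i` has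
dimension the number of characters seen by at least one `f_i`. [cite: Kubota1965, §4 Lemma 2 (proof)] -/
theorem finrank_iSup_span_translates_eq_ncard (f : ι → H → ℚ) :
    Module.finrank ℚ (⨆ i, Submodule.span ℚ (Set.range fun δ : H => fun x : H => f i (x * δ)) :
        Submodule ℚ (H → ℚ)) =
      {ψ : AddChar (Additive H) ℂ | ∃ i, ∑ x : H, (f i x : ℂ) * ψ (Additive.ofMul x) ≠ 0}.ncard := by
  rw [← span_range_prod_eq_iSup, finrank_span_translates_eq_ncard]

omit [Fintype ι] in
/-- **One vector: `dim fℚ[H] = #{ψ : Σ_x f(x)ψ(x) ≠ 0}`** (the support of the Fourier transform).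
[cite: Kubota1965, §2 Lemma 1 and §4 Lemma 2 (proof)] -/
theorem finrank_span_translates_eq_ncard_single (f : H → ℚ) :
    Module.finrank ℚ (Submodule.span ℚ (Set.range fun δ : H => fun x : H => f (x * δ))) =
      {ψ : AddChar (Additive H) ℂ | ∑ x : H, (f x : ℂ) * ψ (Additive.ofMul x) ≠ 0}.ncard := by
  have h := finrank_iSup_span_translates_eq_ncard (ι := Unit) (fun _ => f)
  rw [iSup_const] at h
  rw [h]
  congr 1
  ext ψ
  simp only [Set.mem_setOf_eq, exists_const]

/-- **THE DEFECT IS AN EXCESS MULTIPLICITY OF CHARACTERS**: for rational vectors `f_i` on a finite commutative group,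
`Σ_i dim f_iℚ[H] + #(⋃_i S_i) = Σ_i #S_i + dim Σ_i f_iℚ[H]` with `S_i = {ψ : Σ_x f_i(x)ψ(x) ≠ 0}` — i.e.
`Σ_i dim J_i − dim Σ_i J_i = Σ_i #S_i − #⋃_i S_i = Σ_ψ (n_ψ − 1)⁺`.
[cite: Kubota1965, §4 Lemma 2] [cite: Gordon1999HodgeAVSurvey, Prop. 9.4.1 and 7.7] -/
theorem sum_finrank_add_ncard_iUnion_eq (f : ι → H → ℚ) :
    (∑ i, Module.finrank ℚ (Submodule.span ℚ (Set.range fun δ : H => fun x : H => f i (x * δ)))) +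
        {ψ : AddChar (Additive H) ℂ | ∃ i, ∑ x : H, (f i x : ℂ) * ψ (Additive.ofMul x) ≠ 0}.ncard =
      (∑ i, {ψ : AddChar (Additive H) ℂ | ∑ x : H, (f i x : ℂ) * ψ (Additive.ofMul x) ≠ 0}.ncard) +
        Module.finrank ℚ (⨆ i, Submodule.span ℚ (Set.range fun δ : H => fun x : H => f i (x * δ)) :
          Submodule ℚ (H → ℚ)) := by
  rw [finrank_iSup_span_translates_eq_ncard, Finset.sum_congr rfl fun i _ => finrank_span_translates_eq_ncard_single (f i),
    add_comm]

/-- **Two vectors: `dim(f₀ℚ[H] ∩ f₁ℚ[H]) = #(S₀ ∩ S₁)`** — the ideals meet in the span of the characters seen by BOTH.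
[cite: Kubota1965, §4 Lemma 2] -/
theorem finrank_inf_span_translates_eq_ncard_inter (f₀ f₁ : H → ℚ) :
    Module.finrank ℚ (Submodule.span ℚ (Set.range fun δ : H => fun x : H => f₀ (x * δ)) ⊓
        Submodule.span ℚ (Set.range fun δ : H => fun x : H => f₁ (x * δ)) : Submodule ℚ (H → ℚ)) =
      ({ψ : AddChar (Additive H) ℂ | ∑ x : H, (f₀ x : ℂ) * ψ (Additive.ofMul x) ≠ 0} ∩
        {ψ : AddChar (Additive H) ℂ | ∑ x : H, (f₁ x : ℂ) * ψ (Additive.ofMul x) ≠ 0}).ncard := by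
  have hsup := Submodule.finrank_sup_add_finrank_inf_eq
    (Submodule.span ℚ (Set.range fun δ : H => fun x : H => f₀ (x * δ)))
    (Submodule.span ℚ (Set.range fun δ : H => fun x : H => f₁ (x * δ)))
  have h2 := finrank_iSup_span_translates_eq_ncard (ι := Bool) (fun b => if b then f₁ else f₀)
  rw [show (⨆ b : Bool, Submodule.span ℚ (Set.range fun δ : H => fun x : H => (if b then f₁ else f₀) (x * δ))) =
      Submodule.span ℚ (Set.range fun δ : H => fun x : H => f₀ (x * δ)) ⊔
        Submodule.span ℚ (Set.range fun δ : H => fun x : H => f₁ (x * δ)) from by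
    rw [iSup_bool_eq]; exact sup_comm _ _] at h2
  have hunion : {ψ : AddChar (Additive H) ℂ | ∃ b : Bool, ∑ x : H, ((if b then f₁ else f₀) x : ℂ) *
      ψ (Additive.ofMul x) ≠ 0} =
      {ψ : AddChar (Additive H) ℂ | ∑ x : H, (f₀ x : ℂ) * ψ (Additive.ofMul x) ≠ 0} ∪
        {ψ : AddChar (Additive H) ℂ | ∑ x : H, (f₁ x : ℂ) * ψ (Additive.ofMul x) ≠ 0} := by
    ext ψ
    simp only [Set.mem_setOf_eq, Set.mem_union, Bool.exists_bool, Bool.false_eq_true, if_false, if_true]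
  rw [hunion] at h2
  have h0 := finrank_span_translates_eq_ncard_single f₀
  have h1 := finrank_span_translates_eq_ncard_single f₁
  have hn := Set.ncard_union_add_ncard_inter
    {ψ : AddChar (Additive H) ℂ | ∑ x : H, (f₀ x : ℂ) * ψ (Additive.ofMul x) ≠ 0}
    {ψ : AddChar (Additive H) ℂ | ∑ x : H, (f₁ x : ℂ) * ψ (Additive.ofMul x) ≠ 0}
  omega

end Summit.HodgeConjecture.CorCM.IrrOdd

end
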